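import Mathlib
import Summits.Ventures.PercRepro2.Harris
import Summits.Ventures.PercRepro2.RestrictClosure
import Summits.Ventures.PercRepro2.HCov
import Summits.Ventures.PercRepro2.SepZero
import Summits.Ventures.PercRepro2.SepThreeGates

/-!
# The (SEP-3) class, III: the two blocks, the master pointwise lemma and the product law
(blind cell PercRepro2, typer-1 g49; LEAD-SEP3.md §1, S3-CLASSES §S3.8 and (G7))

`oSide S` / `bSide S` are the events «the restriction of `ω` to `F₁` / `F₂` lies in `S`»
(`F₁ = touches K`, `K = C_{G − {a₁, a₃}}(o)`, `F₂ = F₁ᶜ`); `QXEvent = Q ∩ X` and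
`QYEvent = Q ∩ Xᶜ` read on the blocks (`X = {a₁ ~_o a₃}`), by the gate formula (G1).
`master` packs the ten gate formulas of `SepThreeGates.lean` (both orientations of every
connection atom) with the three transitivity facts the mass identities use (`β ∧ X ⇒ α`,
`α ∧ β ⇒ X`, `Y_l ∧ Y_h ⇒ Y₁`); `prod_law` is the cleared product law on `Q ∩ Xᶜ`
(an `o`-side and a `b`-side event are independent given `Q ∩ Xᶜ`, itself a product event),
and `disjoint_αβ` the disjointness of the `α`- and `β`-pieces there.  `SepThreeMassX.lean` /
`SepThreeMassY.lean` read the thirty-six masses of `Gc` with these.  Own work; standard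
axioms.
-/

namespace Summit.Ventures.PercRepro2

namespace SepThreeGcZero

open CovForm SepPair SepZero UnionCluster

/-! ## Events read on one block -/

section Sides

variable {V : Type*} {E : Type*} (ends : E → Sym2 V) (o a₁ a₂ a₃ : V)

/-- An event read on the `o`-side block `F₁ = touches K`: the restriction of `ω` to `F₁` lies
in `S`. -/
def oSide [DecidablePred (· ∈ touches ends (cluster ends (sepConfig ends {a₁, a₃}) o))]
    (S : Set (Config E)) : Set (Config E) :=
  restrictTo (touches ends (cluster ends (sepConfig ends {a₁, a₃}) o)) ⁻¹' S

/-- An event read on the `b`-side block `F₂ = F₁ᶜ`. -/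
def bSide [DecidablePred (· ∈ (touches ends (cluster ends (sepConfig ends {a₁, a₃}) o))ᶜ)]
    (S : Set (Config E)) : Set (Config E) :=
  restrictTo (touches ends (cluster ends (sepConfig ends {a₁, a₃}) o))ᶜ ⁻¹' S

variable [DecidablePred (· ∈ touches ends (cluster ends (sepConfig ends {a₁, a₃}) o))]
  [DecidablePred (· ∈ (touches ends (cluster ends (sepConfig ends {a₁, a₃}) o))ᶜ)]

/-- `Q ∩ X` read on the blocks: `X ∧ ¬ Y₁ ∧ ¬ Y_h` (`X = a₁ ~_o a₃`, `Y₁ = a₁ ~_b a₂`,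
`Y_h = a₃ ~_b a₂`). -/
def QXEvent : Set (Config E) :=
  oSide ends o a₁ a₃ (connEvent ends a₁ a₃) ∩
    bSide ends o a₁ a₃ (connEvent ends a₁ a₂ ∪ connEvent ends a₃ a₂)ᶜ

/-- `Q ∩ Xᶜ` read on the blocks: `¬ X ∧ ¬ Y₁`. -/
def QYEvent : Set (Config E) :=
  oSide ends o a₁ a₃ (connEvent ends a₁ a₃)ᶜ ∩ bSide ends o a₁ a₃ (connEvent ends a₁ a₂)ᶜ

end Sides

/-! ## The master pointwise lemma, the product law and the disjointness of `α`, `β` -/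

section Master

variable {V : Type*} {E : Type*} {ends : E → Sym2 V} {o a₁ a₂ a₃ b : V}
  [DecidablePred (· ∈ touches ends (cluster ends (sepConfig ends {a₁, a₃}) o))]
  [DecidablePred (· ∈ (touches ends (cluster ends (sepConfig ends {a₁, a₃}) o))ᶜ)]

/-- **The master pointwise lemma**: the ten connection atoms of the five marks in terms of the
block atoms, and the three transitivity facts the mass identities use. -/
theorem master (ho : o ∉ ({a₁, a₃} : Set V))
    (h₂ : a₂ ∉ cluster ends (sepConfig ends {a₁, a₃}) o ∪ {a₁, a₃})
    (hb : b ∉ cluster ends (sepConfig ends {a₁, a₃}) o) (ω : Config E) :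
    (Conn ends ω a₁ a₂ ↔
      Conn ends (restrictTo (touches ends (cluster ends (sepConfig ends {a₁, a₃}) o))ᶜ ω) a₁ a₂ ∨
      (Conn ends (restrictTo (touches ends (cluster ends (sepConfig ends {a₁, a₃}) o)) ω) a₁ a₃ ∧
        Conn ends (restrictTo (touches ends (cluster ends (sepConfig ends {a₁, a₃}) o))ᶜ ω) a₃ a₂)) ∧
    (Conn ends ω a₂ a₁ ↔
      Conn ends (restrictTo (touches ends (cluster ends (sepConfig ends {a₁, a₃}) o))ᶜ ω) a₁ a₂ ∨
      (Conn ends (restrictTo (touches ends (cluster ends (sepConfig ends {a₁, a₃}) o)) ω) a₁ a₃ ∧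
        Conn ends (restrictTo (touches ends (cluster ends (sepConfig ends {a₁, a₃}) o))ᶜ ω) a₃ a₂)) ∧
    (Conn ends ω a₁ o ↔
      Conn ends (restrictTo (touches ends (cluster ends (sepConfig ends {a₁, a₃}) o)) ω) o a₁ ∨
      (Conn ends (restrictTo (touches ends (cluster ends (sepConfig ends {a₁, a₃}) o)) ω) o a₃ ∧
        Conn ends (restrictTo (touches ends (cluster ends (sepConfig ends {a₁, a₃}) o))ᶜ ω) a₃ a₁)) ∧
    (Conn ends ω a₂ o ↔
      (Conn ends (restrictTo (touches ends (cluster ends (sepConfig ends {a₁, a₃}) o)) ω) o a₁ ∧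
        Conn ends (restrictTo (touches ends (cluster ends (sepConfig ends {a₁, a₃}) o))ᶜ ω) a₁ a₂) ∨
      (Conn ends (restrictTo (touches ends (cluster ends (sepConfig ends {a₁, a₃}) o)) ω) o a₃ ∧
        Conn ends (restrictTo (touches ends (cluster ends (sepConfig ends {a₁, a₃}) o))ᶜ ω) a₃ a₂)) ∧
    (Conn ends ω a₁ b ↔
      Conn ends (restrictTo (touches ends (cluster ends (sepConfig ends {a₁, a₃}) o))ᶜ ω) b a₁ ∨
      (Conn ends (restrictTo (touches ends (cluster ends (sepConfig ends {a₁, a₃}) o))ᶜ ω) b a₃ ∧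
        Conn ends (restrictTo (touches ends (cluster ends (sepConfig ends {a₁, a₃}) o)) ω) a₁ a₃)) ∧
    (Conn ends ω a₂ b ↔
      Conn ends (restrictTo (touches ends (cluster ends (sepConfig ends {a₁, a₃}) o))ᶜ ω) b a₂ ∨
      (Conn ends (restrictTo (touches ends (cluster ends (sepConfig ends {a₁, a₃}) o)) ω) a₁ a₃ ∧
        ((Conn ends (restrictTo (touches ends (cluster ends (sepConfig ends {a₁, a₃}) o))ᶜ ω) b a₁ ∧
          Conn ends (restrictTo (touches ends (cluster ends (sepConfig ends {a₁, a₃}) o))ᶜ ω) a₃ a₂) ∨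
        (Conn ends (restrictTo (touches ends (cluster ends (sepConfig ends {a₁, a₃}) o))ᶜ ω) b a₃ ∧
          Conn ends (restrictTo (touches ends (cluster ends (sepConfig ends {a₁, a₃}) o))ᶜ ω) a₁ a₂)))) ∧
    (Conn ends ω a₁ a₃ ↔
      Conn ends (restrictTo (touches ends (cluster ends (sepConfig ends {a₁, a₃}) o)) ω) a₁ a₃ ∨
      Conn ends (restrictTo (touches ends (cluster ends (sepConfig ends {a₁, a₃}) o))ᶜ ω) a₃ a₁) ∧
    (Conn ends ω a₃ a₁ ↔
      Conn ends (restrictTo (touches ends (cluster ends (sepConfig ends {a₁, a₃}) o)) ω) a₁ a₃ ∨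
      Conn ends (restrictTo (touches ends (cluster ends (sepConfig ends {a₁, a₃}) o))ᶜ ω) a₃ a₁) ∧
    (Conn ends ω a₂ a₃ ↔
      Conn ends (restrictTo (touches ends (cluster ends (sepConfig ends {a₁, a₃}) o))ᶜ ω) a₃ a₂ ∨
      (Conn ends (restrictTo (touches ends (cluster ends (sepConfig ends {a₁, a₃}) o)) ω) a₁ a₃ ∧
        Conn ends (restrictTo (touches ends (cluster ends (sepConfig ends {a₁, a₃}) o))ᶜ ω) a₁ a₂)) ∧
    (Conn ends ω a₃ a₂ ↔
      Conn ends (restrictTo (touches ends (cluster ends (sepConfig ends {a₁, a₃}) o))ᶜ ω) a₃ a₂ ∨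
      (Conn ends (restrictTo (touches ends (cluster ends (sepConfig ends {a₁, a₃}) o)) ω) a₁ a₃ ∧
        Conn ends (restrictTo (touches ends (cluster ends (sepConfig ends {a₁, a₃}) o))ᶜ ω) a₁ a₂)) ∧
    (Conn ends (restrictTo (touches ends (cluster ends (sepConfig ends {a₁, a₃}) o)) ω) o a₃ →
      Conn ends (restrictTo (touches ends (cluster ends (sepConfig ends {a₁, a₃}) o)) ω) a₁ a₃ →
      Conn ends (restrictTo (touches ends (cluster ends (sepConfig ends {a₁, a₃}) o)) ω) o a₁) ∧
    (Conn ends (restrictTo (touches ends (cluster ends (sepConfig ends {a₁, a₃}) o)) ω) o a₁ →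
      Conn ends (restrictTo (touches ends (cluster ends (sepConfig ends {a₁, a₃}) o)) ω) o a₃ →
      Conn ends (restrictTo (touches ends (cluster ends (sepConfig ends {a₁, a₃}) o)) ω) a₁ a₃) ∧
    (Conn ends (restrictTo (touches ends (cluster ends (sepConfig ends {a₁, a₃}) o))ᶜ ω) a₃ a₁ →
      Conn ends (restrictTo (touches ends (cluster ends (sepConfig ends {a₁, a₃}) o))ᶜ ω) a₃ a₂ →
      Conn ends (restrictTo (touches ends (cluster ends (sepConfig ends {a₁, a₃}) o))ᶜ ω) a₁ a₂) := by
  have g13 := conn_a₁a₃_iff (ends := ends) ho ω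
  have g13' : Conn ends ω a₁ a₃ ↔
      Conn ends (restrictTo (touches ends (cluster ends (sepConfig ends {a₁, a₃}) o)) ω) a₁ a₃ ∨
      Conn ends (restrictTo (touches ends (cluster ends (sepConfig ends {a₁, a₃}) o))ᶜ ω) a₃ a₁ := by
    rw [g13, conn_comm (ends := ends)
      (ω := restrictTo (touches ends (cluster ends (sepConfig ends {a₁, a₃}) o))ᶜ ω) a₁ a₃]
  refine ⟨conn_a₁a₂_iff ho h₂ ω, (conn_comm a₂ a₁).trans (conn_a₁a₂_iff ho h₂ ω),
    conn_a₁o_iff (ends := ends) ho ω, conn_a₂o_iff ho h₂ ω, conn_a₁b_iff ho hb ω, conn_a₂b_iff ho h₂ hb ω,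
    g13', (conn_comm a₃ a₁).trans g13', conn_a₂a₃_iff ho h₂ ω,
    (conn_comm a₃ a₂).trans (conn_a₂a₃_iff ho h₂ ω), ?_, ?_, ?_⟩
  · exact fun hβ hX => conn_trans hβ (conn_symm hX)
  · exact fun hα hβ => conn_trans (conn_symm hα) hβ
  · exact fun hl hh => conn_trans (conn_symm hl) hh

/-- `α`-events and `β`-events are disjoint inside `Q ∩ Xᶜ` (`α ∧ β ⇒ X`). -/
lemma disjoint_αβ (S₁ S₂ : Set (Config E)) :
    Disjoint (QYEvent ends o a₁ a₂ a₃ ∩ oSide ends o a₁ a₃ (connEvent ends o a₁) ∩ S₁)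
      (QYEvent ends o a₁ a₂ a₃ ∩ oSide ends o a₁ a₃ (connEvent ends o a₃) ∩ S₂) := by
  rw [Set.disjoint_left]
  intro ω h1 h2
  simp only [QYEvent, oSide, bSide, Set.mem_inter_iff, Set.mem_preimage, Set.mem_compl_iff,
    mem_connEvent] at h1 h2
  exact h1.1.1.1 (conn_trans (conn_symm h1.1.2) h2.1.2)

/-- `disjoint_αβ` without a further factor on the `α`-side. -/
lemma disjoint_αβ' (S₂ : Set (Config E)) :
    Disjoint (QYEvent ends o a₁ a₂ a₃ ∩ oSide ends o a₁ a₃ (connEvent ends o a₁))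
      (QYEvent ends o a₁ a₂ a₃ ∩ oSide ends o a₁ a₃ (connEvent ends o a₃) ∩ S₂) := by
  rw [Set.disjoint_left]
  intro ω h1 h2
  simp only [QYEvent, oSide, bSide, Set.mem_inter_iff, Set.mem_preimage, Set.mem_compl_iff,
    mem_connEvent] at h1 h2
  exact h1.1.1 (conn_trans (conn_symm h1.2) h2.1.2)

end Master

section Product

variable {V : Type*} {E : Type*} [Fintype E] [DecidableEq E] {R : Type*} [CommRing R]

/-- **The product law on `Q ∩ Xᶜ`**: an `o`-side event and a `b`-side event are independent
given `Q ∩ Xᶜ` (cleared form). -/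
theorem prod_law (p : E → R) (ends : E → Sym2 V) (o a₁ a₂ a₃ : V)
    [DecidablePred (· ∈ touches ends (cluster ends (sepConfig ends {a₁, a₃}) o))]
    [DecidablePred (· ∈ (touches ends (cluster ends (sepConfig ends {a₁, a₃}) o))ᶜ)]
    (A B : Set (Config E)) :
    prob p (QYEvent ends o a₁ a₂ a₃ ∩ oSide ends o a₁ a₃ A ∩ bSide ends o a₁ a₃ B) *
        prob p (QYEvent ends o a₁ a₂ a₃) =
      prob p (QYEvent ends o a₁ a₂ a₃ ∩ oSide ends o a₁ a₃ A) *
        prob p (QYEvent ends o a₁ a₂ a₃ ∩ bSide ends o a₁ a₃ B) := by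
  have ind : ∀ S T : Set (Config E),
      prob p (oSide ends o a₁ a₃ S ∩ bSide ends o a₁ a₃ T) =
        prob p (oSide ends o a₁ a₃ S) * prob p (bSide ends o a₁ a₃ T) :=
    fun S T => prob_inter_eq_mul_of_dependsOn p disjoint_compl_right
      (dependsOn_restrictTo _ S) (dependsOn_restrictTo _ T)
  have e1 : QYEvent ends o a₁ a₂ a₃ ∩ oSide ends o a₁ a₃ A ∩ bSide ends o a₁ a₃ B =
      oSide ends o a₁ a₃ ((connEvent ends a₁ a₃)ᶜ ∩ A) ∩
        bSide ends o a₁ a₃ ((connEvent ends a₁ a₂)ᶜ ∩ B) := by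
    ext ω
    simp only [QYEvent, oSide, bSide, Set.mem_inter_iff, Set.mem_preimage]
    tauto
  have e2 : QYEvent ends o a₁ a₂ a₃ ∩ oSide ends o a₁ a₃ A =
      oSide ends o a₁ a₃ ((connEvent ends a₁ a₃)ᶜ ∩ A) ∩
        bSide ends o a₁ a₃ (connEvent ends a₁ a₂)ᶜ := by
    ext ω
    simp only [QYEvent, oSide, bSide, Set.mem_inter_iff, Set.mem_preimage]
    tauto
  have e3 : QYEvent ends o a₁ a₂ a₃ ∩ bSide ends o a₁ a₃ B =
      oSide ends o a₁ a₃ (connEvent ends a₁ a₃)ᶜ ∩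
        bSide ends o a₁ a₃ ((connEvent ends a₁ a₂)ᶜ ∩ B) := by
    ext ω
    simp only [QYEvent, oSide, bSide, Set.mem_inter_iff, Set.mem_preimage]
    tauto
  rw [e1, e2, e3, QYEvent, ind, ind, ind, ind]
  ring

end Product


end SepThreeGcZero

end Summit.Ventures.PercRepro2
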